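import Summits.FinalStateConjecture.FinalStateConjecture.Theorems.BartnikGapSettlingBondiBartnikRigiditySlabCauchyRigiditySecondFormKerr
import Literature.Geometry.Lorentzian.MultiCentreRadiationZone
import HarnessLib

/-!
# F1' `stub_slabCauchyRigidity'`, step (b) at order `1`, development side: the second fundamental
# form of a factorised exact collar chart in background coordinates — line
# `direct-method-on-the-cone`, crux `BondiBartnikRigidity` (stmt-FinalStateConjecture-10807);
# module 8 of the landing of the conditional proof of F1' (imports module 7, the Kerr side, for the
# generic rewriting and norm lemmas)

The development-side half of the second fundamental form identity (A2k) of route statement (A)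
`F1Route.SlabSubdatum` (`…SlabCauchyRigidityDefs.lean`), in ABSTRACT form:

* `collar_secondFundamentalForm_chart` — let `Φ₀ : B.domain → 𝒱` be smooth on an open set `L`, let
  `e_N : slabW → L` be the affine slab map `y ↦ Λ(0,y) + c` and `Φ_N : slabW → X` smooth with
  `ι ∘ Φ_N = Φ₀ ∘ e_N`; assume the deviation `Φ₀^* g − g_B` vanishes to first order at the slab points,
  `g_B` is smooth on `L` and nondegenerate at the slab points, and a differentiable representative
  `N : E3 → E4` is pushed by `dΦ₀` to the future unit normal `ν ∘ Φ_N` of the Cauchy hypersurface.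
  Then `k(dΦ_N v, dΦ_N w) = g_B(x)(DN(y) v, Λ(0,w)) + ½ 𝒦_{g_B}(x)(N(y); Λ(0,v), Λ(0,w))`,
  `x = e_N(y)`, with `𝒦` the Koszul form of the components (`OpensChart.koszulForm`) — the same
  metric-free expression as on the Kerr side (`…SlabCauchyRigiditySecondFormKerr.lean`).  Proof:
  `k = K_ν(ι)` (`induced_k`) and naturality under `Φ_N` (`secondFundamentalForm_comp_right`); restrict
  `Φ₀` to the sub-layer `O ∋ x` where `‖Φ₀^* g − (Φ₀^* g)(x)‖ < c/2`, on which `dΦ₀` is injective, pull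
  `g` back to the chart domain `O ⊆ E4` (`secondFundamentalForm_comap`), read the form in coordinates
  (`OpensChart.secondFundamentalForm_eq_of_repr`), expand the Christoffel term
  (`OpensChart.two_mul_val_christoffel`) and replace the `1`-jet of `Φ₀^* g` at `x` by that of `g_B`.
Registered bookkeeping sub-goal of the line: `stub_collarSecondFormChart`.

References: O'Neill 1983, Ch. 3, Prop. 3.13 and Ch. 4, Lemma 4.1, Cor. 4.5 [ONeill1983].  No
definitions, no named facts.
-/

noncomputable section

-- D-0017: single-problem summit, `Summit.<S>.<S>.…` by design (cf. lakefile `weak.linter.dupNamespace`).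
set_option linter.dupNamespace false
set_option maxSynthPendingDepth 3

open Set Filter Function Topology TopologicalSpace Bundle
open Literature.Geometry.Lorentzian
open scoped Manifold ContDiff Topology ENNReal

namespace Summit.FinalStateConjecture.FinalStateConjecture.Theorems.BondiBartnikRigidity.DirectMethod

namespace F1Route

/-! ### The development side of (A2k), abstract form -/

variable {X : Type} [TopologicalSpace X] [ChartedSpace E3 X] [IsManifold (𝓡 3) ∞ X] [ConnectedSpace X]

set_option synthInstance.maxHeartbeats 400000 in
set_option maxHeartbeats 1600000 in
/-- **The second fundamental form of a factorised exact collar chart, in background coordinates.**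
See the module docstring: `k(dΦ_N v, dΦ_N w) = g_B(x)(DN(y) v, Λ(0,w)) + ½ 𝒦_{g_B}(x)(N(y); Λ(0,v), Λ(0,w))`
at `x = e_N(y)`, for `Φ₀` smooth on the open `L ∋ e_N(y)`, `ι ∘ Φ_N = Φ₀ ∘ e_N`, the deviation
`Φ₀^* g − g_B` vanishing to first order at the slab points, `g_B` smooth on `L` and nondegenerate at
the slab points, and `dΦ₀(N) = ν ∘ Φ_N`. [cite: ONeill1983, Ch. 4, Lemma 4.1] -/
theorem collar_secondFundamentalForm_chart {D : InitialDataSet (𝓡 3) X}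
    (𝒱 : VacuumCauchyDevelopment D) {M a : ℝ} (mo : lorentzGroup × E4) (B : ModelBackground)
    (Φ₀ : B.domain → 𝒱.carrier) (ΦN : slabW M a → X) (L : Set B.domain) (hLo : IsOpen L)
    (hΦL₀ : ContMDiffOn 𝓘(ℝ, E4) (𝓡 4) ∞ Φ₀ L)
    (hbs : ∀ x : B.domain, x ∈ L → ContDiffAt ℝ ∞ B.bilin (x : E4))
    (eN : slabW M a → B.domain)
    (heNval : ∀ y, (eN y : E4) = (mo.1 : E4 ≃L[ℝ] E4) (E4.ofTimeSpace 0 (y : E3)) + mo.2)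
    (heNL : ∀ y, eN y ∈ L) (hΦNs : ContMDiff (𝓡 3) (𝓡 3) ((((⊤ : ℕ∞) : WithTop ℕ∞)) + 1) ΦN)
    (hcomp : ∀ y, 𝒱.embed (ΦN y) = Φ₀ (eN y))
    (hdev0 : ∀ y, 𝒱.toSpacetime.deviation B Φ₀ (eN y) = 0)
    (hdev1 : ∀ y, iteratedFDeriv ℝ 1 (𝒱.toSpacetime.deviationExtend B Φ₀) (eN y : E4) = 0)
    (hB0inj : ∀ y, Injective (B.bilin (eN y : E4) : E4 →L[ℝ] E4 →L[ℝ] ℝ))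
    (N : E3 → E4) (hNd : ∀ y : slabW M a, DifferentiableAt ℝ N (y : E3))
    (hnormal : ∀ y, mfderiv 𝓘(ℝ, E4) (𝓡 4) Φ₀ (eN y) (N (y : E3)) = 𝒱.normal (ΦN y))
    (y : slabW M a) (v w : E3) :
    D.k (ΦN y) (mfderiv (𝓡 3) (𝓡 3) ΦN y v) (mfderiv (𝓡 3) (𝓡 3) ΦN y w) =
      B.bilin (eN y : E4) (fderiv ℝ N (y : E3) v) ((mo.1 : E4 ≃L[ℝ] E4) (E4.spaceEmbed w)) +
        2⁻¹ * OpensChart.koszulForm B.bilin (eN y : E4) (N (y : E3))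
          ((mo.1 : E4 ≃L[ℝ] E4) (E4.spaceEmbed v)) ((mo.1 : E4 ≃L[ℝ] E4) (E4.spaceEmbed w)) := by
  haveI hLC : 𝒱.metric.toPseudoRiemannianMetric.HasLeviCivita :=
    𝒱.metric.toPseudoRiemannianMetric.hasLeviCivita
  /- ## notation and elementary facts -/
  set Λ : E4 ≃L[ℝ] E4 := (mo.1 : E4 ≃L[ℝ] E4) with hΛ
  set A : E3 → E4 := fun z => Λ (E4.ofTimeSpace 0 z) + mo.2 with hA
  have hAd : ∀ z, HasFDerivAt A ((Λ : E4 →L[ℝ] E4).comp E4.spaceEmbed) z :=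
    fun z => ((Λ : E4 →L[ℝ] E4).hasFDerivAt.comp z (E4.hasFDerivAt_ofTimeSpace 0 z)).add_const mo.2
  have hAs : ContDiff ℝ ∞ A :=
    ((Λ : E4 →L[ℝ] E4).contDiff.comp (E4.contDiff_ofTimeSpace 0)).add contDiff_const
  have heNA : ∀ y : slabW M a, (eN y : E4) = A (y : E3) := fun y => heNval y
  have heNs : ContMDiff 𝓘(ℝ, E3) 𝓘(ℝ, E4) ∞ eN := by
    rw [← ContMDiff.subtypeVal_comp_iff, show Subtype.val ∘ eN = fun y : slabW M a => A (y : E3)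
      from funext heNA]
    exact (hAs.contMDiff.comp contMDiff_subtype_val).comp contMDiff_subtype_val
  have hdeN : ∀ y : slabW M a, mfderiv 𝓘(ℝ, E3) 𝓘(ℝ, E4) eN y =
      ((Λ : E4 →L[ℝ] E4).comp E4.spaceEmbed) := by
    intro y
    have hdAz : MDifferentiableAt 𝓘(ℝ, E3) 𝓘(ℝ, E4) (fun z : Kerr.slice a M => A z.1) y.1 :=
      ((hAs.contMDiff.comp contMDiff_subtype_val) y.1).mdifferentiableAt (by simp)
    have hd1 : MDifferentiableAt 𝓘(ℝ, E3) 𝓘(ℝ, E4) (fun y : slabW M a => A (y : E3)) y :=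
      (((hAs.contMDiff.comp contMDiff_subtype_val).comp contMDiff_subtype_val) y).mdifferentiableAt
        (by simp)
    rw [OpensChart.mfderiv_codRestrict (U' := B.domain) (φ := eN) (f := fun y : slabW M a => A (y : E3))
        heNA hd1,
      show (fun y : slabW M a => A (y : E3)) = (fun z : Kerr.slice a M => A z.1) ∘ Subtype.val from rfl,
      mfderiv_comp_subtypeVal hdAz,
      show (fun z : Kerr.slice a M => A z.1) = A ∘ Subtype.val from rfl,
      mfderiv_comp_subtypeVal (hAs.contMDiff.contMDiffAt.mdifferentiableAt (by simp)),
      mfderiv_eq_fderiv, (hAd _).fderiv]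
  have hΦ₀at : ∀ y : slabW M a, ContMDiffAt 𝓘(ℝ, E4) (𝓡 4) ∞ Φ₀ (eN y) := fun y =>
    (hΦL₀ _ (heNL y)).contMDiffAt (hLo.mem_nhds (heNL y))
  have hΦ₀d : ∀ y : slabW M a, MDifferentiableAt 𝓘(ℝ, E4) (𝓡 4) Φ₀ (eN y) := fun y =>
    (hΦ₀at y).mdifferentiableAt (by simp)
  have hΦNd : ∀ y, MDifferentiableAt (𝓡 3) (𝓡 3) ΦN y := fun y => (hΦNs y).mdifferentiableAt (by simp)
  -- order-`0` exactness at slab points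
  have hiso : ∀ (y : slabW M a) (v' w' : E4), 𝒱.metric.val (Φ₀ (eN y)) (mfderiv 𝓘(ℝ, E4) (𝓡 4) Φ₀ (eN y) v')
      (mfderiv 𝓘(ℝ, E4) (𝓡 4) Φ₀ (eN y) w') = B.bilin (eN y).1 v' w' := fun y v' w' => by
    have h := congrArg (fun b => b v' w') (hdev0 y)
    simp only [Spacetime.deviation_apply, zero_apply, sub_eq_zero] at h
    exact h
  -- chain rule: `d(ι ∘ Φ_N) = dΦ₀ ∘ Λ ∘ (v ↦ (0, v))`
  have hd : ∀ (y : slabW M a) (u : E3),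
      mfderiv (𝓡 3) (𝓡 4) 𝒱.embed (ΦN y) (mfderiv (𝓡 3) (𝓡 3) ΦN y u) =
        mfderiv 𝓘(ℝ, E4) (𝓡 4) Φ₀ (eN y) (Λ (E4.spaceEmbed u)) := by
    intro y u
    have hfun : 𝒱.embed ∘ ΦN = Φ₀ ∘ eN := funext hcomp
    have h1 : mfderiv 𝓘(ℝ, E3) (𝓡 4) (𝒱.embed ∘ ΦN) y =
        (mfderiv (𝓡 3) (𝓡 4) 𝒱.embed (ΦN y)).comp (mfderiv (𝓡 3) (𝓡 3) ΦN y) :=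
      mfderiv_comp y (𝒱.mdifferentiable_embed _) (hΦNd y)
    have h2 : mfderiv 𝓘(ℝ, E3) (𝓡 4) (Φ₀ ∘ eN) y =
        (mfderiv 𝓘(ℝ, E4) (𝓡 4) Φ₀ (eN y)).comp (mfderiv 𝓘(ℝ, E3) 𝓘(ℝ, E4) eN y) :=
      mfderiv_comp y (hΦ₀d y) (heNs.mdifferentiableAt (by simp))
    rw [hfun, h2, hdeN y] at h1
    exact (DFunLike.congr_fun h1 u).symm
  /- ## Step 1: the left-hand side as the second fundamental form of `ι ∘ Φ_N` -/
  set g := 𝒱.metric.toPseudoRiemannianMetric with hg_def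
  have h_lhs : D.k (ΦN y) (mfderiv (𝓡 3) (𝓡 3) ΦN y v) (mfderiv (𝓡 3) (𝓡 3) ΦN y w) =
      g.secondFundamentalForm 𝓘(ℝ, E3) (𝒱.embed ∘ ΦN) (fun u => 𝒱.normal (ΦN u)) y v w := by
    rw [g.secondFundamentalForm_comp_right (f := 𝒱.embed) (ν := 𝒱.normal) (Ψ := ΦN)
      BoundarylessManifold.isInteriorPoint BoundarylessManifold.isInteriorPoint
      (𝒱.mdifferentiableAt_embed_normal (ΦN y)) (hΦNd y) v w]
    have hk := 𝒱.induced_k (ΦN y)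
    rw [hk, InitialDataSet.kBilin_apply]
  /- ## Step 2: the layer as a chart domain of `E4`, the chart `Φ_L`, its components `G̃` -/
  set LE : Opens E4 := ⟨Subtype.val '' L, B.domain.2.isOpenMap_subtype_val _ hLo⟩ with hLE
  have hLEsub : ∀ z : LE, (z : E4) ∈ (B.domain : Set E4) := fun z => by
    obtain ⟨x, -, hx⟩ := z.2; rw [← hx]; exact x.2
  have hLElayer : ∀ z : LE, (⟨z.1, hLEsub z⟩ : B.domain) ∈ L := fun z => by
    obtain ⟨x, hx, hxz⟩ := z.2
    have : (⟨z.1, hLEsub z⟩ : B.domain) = x := Subtype.ext hxz.symm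
    rw [this]; exact hx
  set jL : LE → B.domain := fun z => ⟨z.1, hLEsub z⟩ with hjL
  have hjLs : ContMDiff 𝓘(ℝ, E4) 𝓘(ℝ, E4) ∞ jL := by
    rw [← ContMDiff.subtypeVal_comp_iff]; exact contMDiff_subtype_val
  have hdjL : ∀ z : LE, mfderiv 𝓘(ℝ, E4) 𝓘(ℝ, E4) jL z = ContinuousLinearMap.id ℝ E4 := fun z => by
    rw [OpensChart.mfderiv_codRestrict (U' := B.domain) (φ := jL) (f := (Subtype.val : LE → E4))
      (fun _ => rfl) ((contMDiff_subtype_val (n := ∞)).mdifferentiableAt (by simp)), mfderiv_subtypeVal]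
  set ΦL : LE → 𝒱.carrier := Φ₀ ∘ jL with hΦL
  have hΦLs : ContMDiff 𝓘(ℝ, E4) (𝓡 4) ∞ ΦL := hΦL₀.comp_contMDiff hjLs hLElayer
  have hdΦL : ∀ z : LE, mfderiv 𝓘(ℝ, E4) (𝓡 4) ΦL z = mfderiv 𝓘(ℝ, E4) (𝓡 4) Φ₀ (jL z) := fun z => by
    have hd0 : MDifferentiableAt 𝓘(ℝ, E4) (𝓡 4) Φ₀ (jL z) :=
      ((hΦL₀ _ (hLElayer z)).contMDiffAt (hLo.mem_nhds (hLElayer z))).mdifferentiableAt (by simp)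
    rw [hΦL, mfderiv_comp z hd0 (hjLs.mdifferentiableAt (by simp)), hdjL]
    exact ContinuousLinearMap.comp_id _
  set BL : ModelBackground := ⟨LE, B.bilin, B.time, B.radius⟩ with hBL
  -- the two deviations agree on the layer
  have hdevL : ∀ z : LE, 𝒱.toSpacetime.deviation BL ΦL z = 𝒱.toSpacetime.deviation B Φ₀ (jL z) := by
    intro z
    ext u u'
    rw [Spacetime.deviation_apply, Spacetime.deviation_apply, hdΦL]
    rfl
  have hdevLext : ∀ z : LE,
      𝒱.toSpacetime.deviationExtend BL ΦL =ᶠ[𝓝 (z : E4)] 𝒱.toSpacetime.deviationExtend B Φ₀ := by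
    intro z
    filter_upwards [LE.2.mem_nhds z.2] with q hq
    rw [show q = ((⟨q, hq⟩ : LE) : E4) from rfl, Spacetime.deviationExtend_coe, hdevL,
      show ((⟨q, hq⟩ : LE) : E4) = ((jL ⟨q, hq⟩ : B.domain) : E4) from rfl, Spacetime.deviationExtend_coe]
  -- the components `G̃ = (Φ_L^* g)` extended, smooth on the layer
  set Gt : E4 → E4 →L[ℝ] E4 →L[ℝ] ℝ := fun q => 𝒱.toSpacetime.deviationExtend BL ΦL q + B.bilin q
    with hGt
  have hGtval : ∀ (z : LE) (u u' : E4), Gt z.1 u u' =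
      𝒱.metric.val (ΦL z) (mfderiv 𝓘(ℝ, E4) (𝓡 4) ΦL z u) (mfderiv 𝓘(ℝ, E4) (𝓡 4) ΦL z u') := by
    intro z u u'
    simp only [hGt]
    rw [add_apply, add_apply, Spacetime.deviationExtend_coe,
      Spacetime.deviation_apply]
    show _ - B.bilin z.1 u u' + B.bilin z.1 u u' = _
    ring
  have hGts : ∀ z : LE, ContDiffAt ℝ ∞ Gt z := fun z => by
    have hb : ContDiffAt ℝ ∞ B.bilin (z : E4) := hbs (jL z) (hLElayer z)
    exact (𝒱.toSpacetime.contDiffAt_deviationExtend_model BL hΦLs z hb).add hb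
  -- the slab point
  have hx₀LE : (eN y : E4) ∈ (LE : Set E4) := ⟨eN y, heNL y, rfl⟩
  set x₀ : LE := ⟨(eN y : E4), hx₀LE⟩ with hx₀
  have hjx₀ : jL x₀ = eN y := Subtype.ext rfl
  have hGt0 : Gt (x₀ : E4) = B.bilin (eN y : E4) := by
    ext u u'
    rw [hGtval, hdΦL, hjx₀, show ΦL x₀ = Φ₀ (eN y) from congrArg Φ₀ hjx₀]
    exact hiso y u u'
  -- nondegeneracy bound of `g_B` at the slab point, and the sub-layer `O`
  obtain ⟨c, hc, hcb⟩ := exists_bound_of_injective _ (hB0inj y)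
  have hGtcont : ContinuousOn Gt (LE : Set E4) := fun q hq => (hGts ⟨q, hq⟩).continuousAt.continuousWithinAt
  set Oset : Set E4 := (LE : Set E4) ∩ Gt ⁻¹' Metric.ball (Gt (x₀ : E4)) (c / 2) with hOset
  have hOopen : IsOpen Oset := hGtcont.isOpen_inter_preimage LE.2 Metric.isOpen_ball
  set O : Opens E4 := ⟨Oset, hOopen⟩ with hO
  have hOx₀ : (x₀ : E4) ∈ O := ⟨x₀.2, Metric.mem_ball_self (by positivity)⟩
  set jO : O → LE := fun z => ⟨z.1, z.2.1⟩ with hjO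
  have hjOs : ContMDiff 𝓘(ℝ, E4) 𝓘(ℝ, E4) ∞ jO := by
    rw [← ContMDiff.subtypeVal_comp_iff]; exact contMDiff_subtype_val
  have hdjO : ∀ z : O, mfderiv 𝓘(ℝ, E4) 𝓘(ℝ, E4) jO z = ContinuousLinearMap.id ℝ E4 := fun z => by
    rw [OpensChart.mfderiv_codRestrict (U' := LE) (φ := jO) (f := (Subtype.val : O → E4))
      (fun _ => rfl) ((contMDiff_subtype_val (n := ∞)).mdifferentiableAt (by simp)), mfderiv_subtypeVal]
  set ΦO : O → 𝒱.carrier := ΦL ∘ jO with hΦO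
  have hΦOs : ContMDiff 𝓘(ℝ, E4) (𝓡 4) ∞ ΦO := hΦLs.comp hjOs
  have hΦOs' : ContMDiff 𝓘(ℝ, E4) (𝓡 4) ((((⊤ : ℕ∞) : WithTop ℕ∞)) + 1) ΦO := hΦOs
  have hdΦO : ∀ z : O, mfderiv 𝓘(ℝ, E4) (𝓡 4) ΦO z = mfderiv 𝓘(ℝ, E4) (𝓡 4) ΦL (jO z) := fun z => by
    rw [hΦO, mfderiv_comp z (hΦLs.mdifferentiableAt (by simp)) (hjOs.mdifferentiableAt (by simp)), hdjO]
    exact ContinuousLinearMap.comp_id _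
  have hΦO' : ∀ z : O, Injective (mfderiv 𝓘(ℝ, E4) (𝓡 4) ΦO z) := by
    intro z
    refine (injective_iff_map_eq_zero (mfderiv 𝓘(ℝ, E4) (𝓡 4) ΦO z)).2 fun u hu => ?_
    have hz : ‖Gt z.1 - Gt (x₀ : E4)‖ < c := by
      have hz' : dist (Gt z.1) (Gt x₀) < c / 2 := z.2.2
      rw [dist_eq_norm] at hz'
      linarith
    have hGB : ∀ u : E4, c * ‖u‖ ≤ ‖Gt (x₀ : E4) u‖ := by rw [hGt0]; exact hcb
    have hu' : mfderiv 𝓘(ℝ, E4) (𝓡 4) ΦL (jO z) u = 0 := by rw [← hdΦO]; exact hu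
    exact nondegenerate_of_norm_sub_lt hGB hz u fun w' => by
      rw [show Gt z.1 = Gt (jO z).1 from rfl, hGtval, hu', map_zero, zero_apply]
  /- ## Step 3: the pulled-back metric `g̃ = Φ_O^* g` on `O` and its components -/
  set gt := g.comap PseudoRiemannianMetric.contMDiff_pullbackBilin_holds ΦO hΦOs' hΦO' rfl with hgt
  haveI hgtLC : gt.HasLeviCivita := gt.hasLeviCivita
  have hGtO : ∀ z : O, gt.val z = Gt z.1 := fun z => by
    ext u u'
    rw [hgt, PseudoRiemannianMetric.val_comap, pullbackBilin_apply, show Gt z.1 = Gt (jO z).1 from rfl]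
    erw [hGtval, hdΦO]
    rfl
  /- ## Step 4: source localisation `{M < r(0,·) < 3M} ∩ A⁻¹(O)` and the maps `e_{N,T}`, `e_{N,B}` -/
  set SN : Set E3 := {z : E3 | max M 0 < Kerr.radius a (E4.ofTimeSpace 0 z) ∧
      Kerr.radius a (E4.ofTimeSpace 0 z) < 3 * M} ∩ A ⁻¹' (O : Set E4) with hSN
  have hSNopen : IsOpen SN :=
    ((isOpen_lt continuous_const ((Kerr.continuous_radius a).comp (E4.continuous_ofTimeSpace 0))).inter
      (isOpen_lt ((Kerr.continuous_radius a).comp (E4.continuous_ofTimeSpace 0)) continuous_const)).inter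
      (hOopen.preimage hAs.continuous)
  set slabN' : Opens E3 := ⟨SN, hSNopen⟩ with hslabN'
  have hAy : A (y : E3) = (x₀ : E4) := (heNA y).symm
  have hu₀mem : (y : E3) ∈ slabN' := ⟨⟨y.1.2, y.2⟩, by show A (y : E3) ∈ Oset; rw [hAy]; exact hOx₀⟩
  set u₀ : slabN' := ⟨(y : E3), hu₀mem⟩ with hu₀
  -- the identity reparametrisation `slabN' → slabW`
  set Θ' : slabN' → slabW M a := fun u => ⟨⟨u.1, u.2.1.1⟩, u.2.1.2⟩ with hΘ'
  have hΘ's : ContMDiff 𝓘(ℝ, E3) 𝓘(ℝ, E3) ∞ Θ' := by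
    have h1 : ContMDiff 𝓘(ℝ, E3) 𝓘(ℝ, E3) ∞ (fun u : slabN' => (⟨u.1, u.2.1.1⟩ : Kerr.slice a M)) := by
      rw [← ContMDiff.subtypeVal_comp_iff]; exact contMDiff_subtype_val
    rw [← ContMDiff.subtypeVal_comp_iff]; exact h1
  have hΘ'mf : ∀ (u : slabN') (v' : E3), mfderiv 𝓘(ℝ, E3) 𝓘(ℝ, E3) Θ' u v' = v' := by
    intro u v'
    have hd0 : MDifferentiableAt 𝓘(ℝ, E3) 𝓘(ℝ, E3) (Subtype.val : slabN' → E3) u :=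
      (contMDiff_subtype_val (n := ∞)).mdifferentiableAt (by simp)
    have hd1 : MDifferentiableAt 𝓘(ℝ, E3) 𝓘(ℝ, E3)
        (fun u : slabN' => (⟨u.1, u.2.1.1⟩ : Kerr.slice a M)) u :=
      OpensChart.mdifferentiableAt_codRestrict (U' := Kerr.slice a M)
        (φ := fun u : slabN' => (⟨u.1, u.2.1.1⟩ : Kerr.slice a M))
        (f := (Subtype.val : slabN' → E3)) (fun _ => rfl) hd0
    rw [OpensChart.mfderiv_codRestrict (U' := slabW M a) (φ := Θ')
        (f := fun u : slabN' => (⟨u.1, u.2.1.1⟩ : Kerr.slice a M)) (fun _ => rfl) hd1,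
      OpensChart.mfderiv_codRestrict (U' := Kerr.slice a M)
        (φ := fun u : slabN' => (⟨u.1, u.2.1.1⟩ : Kerr.slice a M))
        (f := (Subtype.val : slabN' → E3)) (fun _ => rfl) hd0,
      mfderiv_subtypeVal]
    rfl
  have hΘ'd : ∀ u : slabN', MDifferentiableAt 𝓘(ℝ, E3) 𝓘(ℝ, E3) Θ' u := fun u =>
    (hΘ's u).mdifferentiableAt (by simp)
  set eNT : slabN' → O := fun u => ⟨A u.1, u.2.2⟩ with heNT
  set eNB : slabN' → B.domain := fun u => eN (Θ' u) with heNB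
  have heNBval : ∀ u : slabN', (eNB u : E4) = A u.1 := fun u => heNA (Θ' u)
  set ν₂ : slabN' → E4 := fun u => N u.1 with hν₂
  have hAdiff : ∀ u : slabN', DifferentiableAt ℝ A u.1 := fun u => (hAd _).differentiableAt
  have hNdiff : ∀ u : slabN', DifferentiableAt ℝ N u.1 := fun u => hNd (Θ' u)
  have hcoe : ((eNT u₀ : O) : E4) = (eN y : E4) := (heNA y).symm
  -- the LHS second fundamental form, reparametrised over `slabN'`
  have h_loc : g.secondFundamentalForm 𝓘(ℝ, E3) (𝒱.embed ∘ ΦN) (fun u => 𝒱.normal (ΦN u)) y v w =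
      g.secondFundamentalForm 𝓘(ℝ, E3) ((𝒱.embed ∘ ΦN) ∘ Θ')
        (fun u => 𝒱.normal (ΦN (Θ' u))) u₀ v w := by
    have h1 := g.secondFundamentalForm_comp_right (IX := 𝓘(ℝ, E3)) (IN := 𝓘(ℝ, E3))
      (f := 𝒱.embed ∘ ΦN) (ν := fun u => 𝒱.normal (ΦN u))
      (Ψ := Θ') (u := u₀) BoundarylessManifold.isInteriorPoint BoundarylessManifold.isInteriorPoint
      ((𝒱.mdifferentiableAt_embed_normal _).comp _ (hΦNd _)) (hΘ'd u₀) v w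
    rw [hΘ'mf, hΘ'mf] at h1
    exact h1.symm
  -- the incidences `j_L ∘ j_O ∘ e_{N,T} = e_{N,B} = e_N ∘ Θ'`
  have hjj : ∀ u : slabN', jL (jO (eNT u)) = eNB u := fun u => Subtype.ext (heNA (Θ' u)).symm
  have h_congr : g.secondFundamentalForm 𝓘(ℝ, E3) ((𝒱.embed ∘ ΦN) ∘ Θ')
        (fun u => 𝒱.normal (ΦN (Θ' u))) u₀ =
      g.secondFundamentalForm 𝓘(ℝ, E3) (ΦO ∘ eNT)
        (fun u => mfderiv 𝓘(ℝ, E4) (𝓡 4) ΦO (eNT u) (ν₂ u)) u₀ := by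
    refine secondFundamentalForm_congr_pair g 𝓘(ℝ, E3) (funext fun u => ?_) (fun u => ?_) u₀
    · show 𝒱.embed (ΦN (Θ' u)) = Φ₀ (jL (jO (eNT u)))
      rw [hcomp, hjj]
    · show 𝒱.normal (ΦN (Θ' u)) = mfderiv 𝓘(ℝ, E4) (𝓡 4) ΦO (eNT u) (N u.1)
      rw [hdΦO, hdΦL, hjj]
      exact (hnormal (Θ' u)).symm
  have hνlift : MDifferentiableAt 𝓘(ℝ, E3) 𝓘(ℝ, E4).tangent
      (fun u => (TotalSpace.mk' E4 (eNT u) (ν₂ u) : TangentBundle 𝓘(ℝ, E4) O)) u₀ :=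
    OpensChart.mdifferentiableAt_lift_of_repr (f := eNT) (Φ := A) (fun _ => rfl) (ν := ν₂)
      (N := N) (fun _ => rfl) (hAdiff u₀) (hNdiff u₀)
  have h_comap : g.secondFundamentalForm 𝓘(ℝ, E3) (ΦO ∘ eNT)
        (fun u => mfderiv 𝓘(ℝ, E4) (𝓡 4) ΦO (eNT u) (ν₂ u)) u₀ =
      gt.secondFundamentalForm 𝓘(ℝ, E3) eNT ν₂ u₀ :=
    (g.secondFundamentalForm_comap PseudoRiemannianMetric.contMDiff_pullbackBilin_holds hΦOs' hΦO' rfl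
      (f := eNT) (ν := ν₂) BoundarylessManifold.isInteriorPoint hνlift).symm
  have hGtd : DifferentiableAt ℝ Gt (eNT u₀ : E4) := by
    rw [hcoe]; exact (hGts x₀).differentiableAt (by simp)
  have h_chartV : gt.secondFundamentalForm 𝓘(ℝ, E3) eNT ν₂ u₀ v w =
      gt.val (eNT u₀) (fderiv ℝ N (y : E3) v +
        OpensChart.christoffel gt Gt (eNT u₀) (N (y : E3)) (fderiv ℝ A (y : E3) v)) (fderiv ℝ A (y : E3) w) :=
    OpensChart.secondFundamentalForm_eq_of_repr (g := gt) (G := Gt) hGtO (f := eNT) (Φ := A)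
      (fun _ => rfl) (ν := ν₂) (N := N) (fun _ => rfl) (hAdiff u₀) (hNdiff u₀) hGtd v w
  /- ## Step 5: the `1`-jet of `G̃` at the slab point is that of `g_B` -/
  have hDdev : fderiv ℝ (𝒱.toSpacetime.deviationExtend BL ΦL) (x₀ : E4) = 0 := by
    have h1L : iteratedFDeriv ℝ 1 (𝒱.toSpacetime.deviationExtend BL ΦL) (x₀ : E4) = 0 := by
      rw [((hdevLext x₀).iteratedFDeriv ℝ 1).eq_of_nhds]; exact hdev1 y
    ext u u' u''
    have e := congrArg (fun F => F (fun _ => u)) h1L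
    simp only [iteratedFDeriv_one_apply, zero_apply] at e
    rw [e]
    rfl
  have hD : fderiv ℝ Gt (eN y : E4) = fderiv ℝ B.bilin (eN y : E4) := by
    have hb' : ContDiffAt ℝ ∞ B.bilin (x₀ : E4) := hbs (jL x₀) (hLElayer x₀)
    have hb : DifferentiableAt ℝ B.bilin (x₀ : E4) := hb'.differentiableAt (by simp)
    have hdL : DifferentiableAt ℝ (𝒱.toSpacetime.deviationExtend BL ΦL) (x₀ : E4) :=
      (𝒱.toSpacetime.contDiffAt_deviationExtend_model BL hΦLs x₀ hb').differentiableAt (by simp)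
    have e : Gt = 𝒱.toSpacetime.deviationExtend BL ΦL + B.bilin := by funext q; rfl
    show fderiv ℝ Gt (x₀ : E4) = fderiv ℝ B.bilin (x₀ : E4)
    rw [e, fderiv_add hdL hb, hDdev, zero_add]
  have hGt0' : Gt (eN y : E4) = B.bilin (eN y : E4) := hGt0
  have hK : ∀ Y X W : E4, OpensChart.koszulForm Gt (eN y : E4) Y X W =
      OpensChart.koszulForm B.bilin (eN y : E4) Y X W := fun Y X W => by
    simp only [OpensChart.koszulForm_apply, hD]
  -- assemble
  rw [h_lhs, h_loc, congrArg (fun K => K v w) h_congr, congrArg (fun K => K v w) h_comap, h_chartV,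
    val_add_christoffel_eq (eNT u₀) (hGtO (eNT u₀)), (hAd _).fderiv, hcoe, hGt0', hK]
  rfl

end F1Route

open F1Route in
/-- **Registered bookkeeping sub-goal `stub_collarSecondFormChart` of the line** (brick of the
landing of F1' `stub_slabCauchyRigidity'`): the development side of the second fundamental form
identity in abstract chart form (see `F1Route.collar_secondFundamentalForm_chart`).
[cite: ONeill1983, Ch. 4, Lemma 4.1] -/
theorem stub_collarSecondFormChart : ∀ {X : Type} [TopologicalSpace X] [ChartedSpace E3 X]
    [IsManifold (𝓡 3) ∞ X] [ConnectedSpace X] {D : InitialDataSet (𝓡 3) X} (𝒱 : VacuumCauchyDevelopment D) {M a : ℝ}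
    (mo : lorentzGroup × E4) (B : ModelBackground) (Φ₀ : B.domain → 𝒱.carrier)
    (ΦN : F1Route.slabW M a → X) (L : Set B.domain), IsOpen L →
    ContMDiffOn 𝓘(ℝ, E4) (𝓡 4) ∞ Φ₀ L → (∀ x : B.domain, x ∈ L → ContDiffAt ℝ ∞ B.bilin (x : E4)) →
    ∀ (eN : F1Route.slabW M a → B.domain),
    (∀ y, (eN y : E4) = (mo.1 : E4 ≃L[ℝ] E4) (E4.ofTimeSpace 0 (y : E3)) + mo.2) → (∀ y, eN y ∈ L) →
    ContMDiff (𝓡 3) (𝓡 3) ((((⊤ : ℕ∞) : WithTop ℕ∞)) + 1) ΦN → (∀ y, 𝒱.embed (ΦN y) = Φ₀ (eN y)) →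
    (∀ y, 𝒱.toSpacetime.deviation B Φ₀ (eN y) = 0) →
    (∀ y, iteratedFDeriv ℝ 1 (𝒱.toSpacetime.deviationExtend B Φ₀) (eN y : E4) = 0) →
    (∀ y, Injective (B.bilin (eN y : E4) : E4 →L[ℝ] E4 →L[ℝ] ℝ)) →
    ∀ (N : E3 → E4), (∀ y : F1Route.slabW M a, DifferentiableAt ℝ N (y : E3)) →
    (∀ y, mfderiv 𝓘(ℝ, E4) (𝓡 4) Φ₀ (eN y) (N (y : E3)) = 𝒱.normal (ΦN y)) →
    ∀ (y : F1Route.slabW M a) (v w : E3),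
    D.k (ΦN y) (mfderiv (𝓡 3) (𝓡 3) ΦN y v) (mfderiv (𝓡 3) (𝓡 3) ΦN y w) =
      B.bilin (eN y : E4) (fderiv ℝ N (y : E3) v) ((mo.1 : E4 ≃L[ℝ] E4) (E4.spaceEmbed w)) +
        2⁻¹ * OpensChart.koszulForm B.bilin (eN y : E4) (N (y : E3))
          ((mo.1 : E4 ≃L[ℝ] E4) (E4.spaceEmbed v)) ((mo.1 : E4 ≃L[ℝ] E4) (E4.spaceEmbed w)) :=
  @collar_secondFundamentalForm_chart

end Summit.FinalStateConjecture.FinalStateConjecture.Theorems.BondiBartnikRigidity.DirectMethod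

end
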